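import Literature.MathematicalPhysics.StatisticalMechanics.StickyDiscWulffShape
import Literature.Geometry.DiscreteGeometry.HeitmannRadinHexagon
import Mathlib.Analysis.Complex.Isometry
import Mathlib.Topology.EMetricSpace.Lipschitz
import Mathlib.Analysis.SpecialFunctions.Pow.Real
import HarnessLib

/-!
# Schmidt 2013: fine properties of sticky-disc ground states and the `N^{3/4}` law for the
# deviation from the asymptotic Wulff shape

Topic `Literature/MathematicalPhysics/StatisticalMechanics`; cross-ladder literature-typing layer
(D-0088 (4)), cell `crystal3d-full`, seat `littype-FC1-2` (gen 5).  Companion of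
`StickyDiscWulffShape.lean` (Au Yeung–Friesecke–Schmidt 2012: Wulff hexagon of sticky-disc ground
states) and of `LatticeMaximalFluctuations.lean` (Cicalese–Leonardi 2020, which re-derives the present
`N^{3/4}` law by quantitative Wulff inequalities, `CicaleseLeonardi2020_triangular`).  The source is the
ORIGIN of the maximal-fluctuation (`N^{3/4}`) law of row (4); it had no named fact in the tree
(`UnitDiscContactNumber.lean`: "Wulff shapes (Au Yeung–Friesecke–Schmidt 2012, Schmidt 2013): other
files").

## Source, as printed

B. Schmidt, *Ground states of the 2D sticky disc model: fine properties and `N^{3/4}` law for the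
deviation from the asymptotic Wulff shape*, J. Stat. Phys. **153** (2013) 727–738 [Schmidt2013] — read
on the held arXiv text `paper:arxiv-1302.6513` (theorem numbers as there; `pNNNN` = chunk of the
held text).

* §1 (p0003): (1.1) `E = Σ_{i≠j} V_HR(|xᵢ − xⱼ|)`, (1.2) `V_HR = +∞ / −1 / 0` on `[0,1) / {1} / (1,∞)`,
  (1.3) `μ_N = N⁻¹ Σⱼ δ_{N^{−1/2} xⱼ}`, (1.4) "satisfies, up to translation and rotation,
  `μ_N ⇀* ρ₀ χ_h`, where `χ_h` is the characteristic function of the regular hexagon `h` with corners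
  `±(1/√3)(1,0)`, `±(1/(2√3))(1,√3)`, `±(1/(2√3))(−1,√3)`, and `ρ₀ = 2/√3`".
* §2 (p0005): ground states are, without loss of generality, subsets of
  `𝓛 = {m e₁ + n e₂}`, `e₁ = (1,0)`, `e₂ = ½(1,√3)` (Theorem 2.1 = [Harborth, Heitmann–Radin]);
  "So in the following results it is no loss of generality to (tacitly) assume that `N` be
  sufficiently large."
* §2 (p0007), the flat norm: "`‖μ‖ := sup{∫ φ dμ : φ Lipschitz with |φ| ≤ 1 and Lipschitz constant ≤ 1}`".
* **Theorem 2.4** (p0007). "Suppose `S_N ⊂ 𝓛` is a ground state. There is a constant `C`,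
  independent of `N`, such that `μ_N`, after a suitable translation, satisfies `‖μ_N − μ‖ ≤ C N^{−1/4}`."
  (`μ = ρ₀ χ_h`, (1.4).)
* **Proposition 2.5** ([Heitmann–Radin], p0007): the hexagon-plus-partial-row configurations `S_N'`
  are ground states — in the tree this is Harborth's spiral `exists_injective_contactPairCount_eq_harborthNumber`
  (`HarborthConstruction.lean`), not restated.
* **Theorem 2.6** (p0007–p0008). "There exists a constant `c > 0`, independent of `N`, such that for
  infinitely many `N ∈ ℕ` there are two ground states `S_N'` and `S̃_N` with `N` atoms such that
  `inf{‖μ_N' − μ̃_N(R · + a)‖ : R ∈ O(2), a ∈ ℝ²} ≥ c N^{−1/4}`, where `μ_N' = N⁻¹ Σ_{x∈S_N'} δ_{x/√N}`,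
  `μ̃_N = N⁻¹ Σ_{x∈S̃_N} δ_{x/√N}`."
* **Proposition 2.7** (p0008). "Suppose `N = 3k(k+1) + 1` for some `k`. The ground state is (up to
  rigid motions) uniquely given by `S_N = 𝓛 ∩ conv(B₁^{(k)},…,B₆^{(k)})`", where (p0007)
  `B₁ = k(e₁ − e₂)`, `B₂ = k e₁`, `B₃ = k e₂`, `B₄ = −B₁`, `B₅ = −B₂`, `B₆ = −B₃`.

## Rendering

* Configurations, ground states, the lattice and the re-scaled empirical measures are those of
  `StickyDiscWulffShape.lean` / `UnitDiscContactNumber.lean`: a ground state of the sticky disc energy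
  is a maximal disc configuration `IsMaximalDiscConfig x` (`isGroundState_stickyPotential_iff`),
  `∫ φ dμ_N = empiricalIntegral x φ`, `h = wulffHexagon`, `𝓛 = Theil2006.triangularLattice`.
* The flat norm (sup over `1`-Lipschitz `φ` with `|φ| ≤ 1`) of a signed measure is typed through its
  action on test functions: `flatNorm L = sup{L φ}` for the functional `L : (ℝ² → ℝ) → ℝ`
  (`φ ↦ ∫ φ dμ_N − ρ₀ ∫_h φ`, resp. `φ ↦ ∫ φ dμ_N' − ∫ φ dμ̃_N(R · + a)`); a real `sSup` (junk `0`
  on unbounded sets, which do not occur here: `|∫ φ dμ_N| ≤ 1`, `abs_empiricalIntegral_le_one`).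
* As in `StickyDiscWulffShape.lean`, translating / rigidly moving a re-scaled empirical measure is
  moving the configuration (`μ_N(R · + a)` is the re-scaled empirical measure of `R⁻¹S_N − √N R⁻¹a`;
  the families over `O(2) × ℝ²` coincide); "R ∈ O(2)" = linear isometry; "rigid motion" (Prop. 2.7)
  = linear isometry followed by a translation (the weaker reading; the target set is symmetric).
* "tacitly … `N` sufficiently large" is an explicit threshold `N₀` (resp. `k₀`) in each fact.
* `𝓛 ∩ conv(B₁^{(k)},…,B₆^{(k)})` — the lattice points of the regular hexagon with the six corners
  `±k e₁, ±k e₂, ±k(e₂ − e₁)` — is, in labels, the tree's lattice hexagon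
  `HarborthSpiral.hexagon k = {(m,n) : |m|, |n|, |m+n| ≤ k}` (its three pairs of constraints are the
  support half-planes of that hexagon), of cardinality `3k(k+1)+1` (`card_hexagon`, from the tree's
  `HarborthSpiral.count_hexagon`); typed as `triPoint '' hexagon k`.

## Contents (namespace `Literature.MathematicalPhysics.StatisticalMechanics.Schmidt2013`)

`flatNorm`; NAMED FACTS `Schmidt2013_deviationUpperBound` (Theorem 2.4), `Schmidt2013_deviationLowerBound`
(Theorem 2.6), `Schmidt2013_uniqueGroundState` (Proposition 2.7); PROVED `abs_empiricalIntegral_le_one`,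
`card_hexagon` (`#(𝓛 ∩ conv B^{(k)}) = 3k(k+1) + 1`, consistency of Proposition 2.7's particle number).
§5 (gen 7): **Proposition 2.7 PROVED** — `Schmidt2013_uniqueGroundState_holds` (threshold `k₀ = 0`), from
`Harborth.eq_image_hexagon_of_maximal` (`HeitmannRadinHexagon.lean`: a maximal configuration of `3k(k+1)+1`
unit discs is a congruent copy of the lattice hexagon `H_k`, by induction on `k` along Heitmann–Radin's
peeling — the interior of a hexagonal-number ground state is again a hexagonal-number ground state — in
place of the printed Euler-formula / Wulff-uniqueness (Taylor, Fonseca–Müller) argument).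
DISCHARGED DOWNSTREAM (all three named facts of this file are now theorems): **Theorem 2.4** —
`Schmidt2013_deviationUpperBound_holds` in `TriangularLatticeWulffShape.lean` (`C = 2K_t + 113`, `N₀ = 13`,
via Davoli–Piovano–Stefanelli's flat-norm estimate); **Theorem 2.6** — `Schmidt2013_deviationLowerBound_holds`
in `StickyDiscDeviationLowerBound.lean` (`c = 1/2400`; the swept lattice hexagon `D(a,L)`, `L = ⌊√a⌋`, against
Harborth's spiral configuration, separated uniformly over rigid motions by the admissible test function
`¼ min(⟨· − a/√N, Re₂⟩², 4)` — a clipped second moment — in place of the printed symmetric-difference step).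

WHAT IS NOT HERE: Theorem 2.1 (Harborth / Heitmann–Radin; tree: `Harborth1974_contactNumber_holds`,
`HeitmannRadin1980_groundStates_holds`, `Harborth.HeitmannRadin_polygon`, `Harborth.card_bdrySet_of_maximal`);
Lemmas 2.2–2.3 (fine structure of the boundary polygon: at most one `π/3`-corner, staircases, the
normalized ground state `S_N^{(n)}`); Proposition 2.5 (see above); Theorem 2.8 (Taylor / Fonseca–Müller);
the equivalence (up to `C N^{−1}`) of the flat-norm and Voronoi-`L¹` deviations remarked on p0007.
-/

noncomputable section

open MeasureTheory Set Filter Function Metric Finset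
open scoped ENNReal Topology Pointwise

namespace Literature.MathematicalPhysics.StatisticalMechanics.Schmidt2013

open Literature.Geometry.DiscreteGeometry (contactPairCount IsMaximalDiscConfig)
open Literature.Geometry.DiscreteGeometry.HarborthSpiral (hexagon count_hexagon)
open Theil2006 (Plane triPoint triangularLattice)
open AuYeungFrieseckeSchmidt2012 (empiricalIntegral wulffHexagon)

variable {N : ℕ}

/-! ## §1 The flat norm -/

/-- **The flat norm** `‖μ‖ := sup{∫ φ dμ : φ Lipschitz with |φ| ≤ 1 and Lipschitz constant ≤ 1}` of a
(signed) measure `μ`, typed through the action `L : φ ↦ ∫ φ dμ` of `μ` on test functions.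
[cite: Schmidt2013, §2 (definition of `‖μ‖`, flat norm) (arXiv text p0007)] -/
def flatNorm (L : (Plane → ℝ) → ℝ) : ℝ :=
  sSup {t : ℝ | ∃ φ : Plane → ℝ, LipschitzWith 1 φ ∧ (∀ y, |φ y| ≤ 1) ∧ t = L φ}

/-- `|∫ φ dμ_N| ≤ 1` for `|φ| ≤ 1` (the re-scaled empirical measure has mass `≤ 1`).
[cite: Schmidt2013, (1.3) (p0003)] -/
theorem abs_empiricalIntegral_le_one (x : Fin N → Plane) {φ : Plane → ℝ} (hφ : ∀ y, |φ y| ≤ 1) :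
    |empiricalIntegral x φ| ≤ 1 := by
  unfold empiricalIntegral
  rcases Nat.eq_zero_or_pos N with rfl | hN
  · simp
  have hN' : (0 : ℝ) < N := by exact_mod_cast hN
  rw [abs_mul, abs_inv, abs_of_pos hN']
  calc (N : ℝ)⁻¹ * |∑ i, φ ((Real.sqrt N)⁻¹ • x i)| ≤ (N : ℝ)⁻¹ * ∑ i : Fin N, (1 : ℝ) := by
        gcongr
        exact (abs_sum_le_sum_abs _ _).trans (sum_le_sum fun i _ => hφ _)
    _ = 1 := by simp [hN'.ne']

/-! ## §2 Theorem 2.4: the upper bound `‖μ_N − ρ₀ χ_h‖ ≤ C N^{−1/4}` -/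

/-- **Schmidt 2013, Theorem 2.4 (upper bound on the deviation from the Wulff hexagon), NAMED FACT.**
There are a constant `C` and a threshold `N₀` ("`N` sufficiently large", p0005) such that for every
`N ≥ N₀` and every ground state `S_N ⊂ 𝓛` of the sticky disc energy with `N` atoms, after a suitable
translation `a`, the re-scaled empirical measure `μ_N = N⁻¹ Σ δ_{x/√N}` satisfies
`‖μ_N − ρ₀ χ_h‖ ≤ C N^{−1/4}` in the flat norm, where `ρ₀ = 2/√3` and `h` is the regular hexagon with
corners `±(1/√3)(1,0)`, `±(1/(2√3))(±1,√3)` (`wulffHexagon`).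
[cite: Schmidt2013, Theorem 2.4 (p0007); (1.4) (p0003)] -/
def Schmidt2013_deviationUpperBound : Prop :=
  ∃ (C : ℝ) (N₀ : ℕ), ∀ N : ℕ, N₀ ≤ N → ∀ x : Fin N → Plane, IsMaximalDiscConfig x →
    (∀ i, x i ∈ triangularLattice) →
      ∃ a : Plane,
        flatNorm (fun φ => empiricalIntegral (fun i => x i + a) φ -
            2 / Real.sqrt 3 * ∫ y in wulffHexagon, φ y) ≤
          C * (N : ℝ) ^ (-(1 / 4 : ℝ))

/-! ## §3 Theorem 2.6: the lower bound (sharpness) -/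

/-- **Schmidt 2013, Theorem 2.6 (the rate `N^{−1/4}` is optimal), NAMED FACT.**  There is `c > 0` such
that for infinitely many `N` there are two ground states `S_N'`, `S̃_N` of the sticky disc energy with `N`
atoms whose re-scaled empirical measures satisfy `‖μ_N' − μ̃_N(R · + a)‖ ≥ c N^{−1/4}` for every
`R ∈ O(2)` and `a ∈ ℝ²` (the measure `μ̃_N(R · + a)` being the re-scaled empirical measure of the rigidly
moved configuration). [cite: Schmidt2013, Theorem 2.6 (p0007–p0008)] -/
def Schmidt2013_deviationLowerBound : Prop :=
  ∃ c : ℝ, 0 < c ∧ ∀ N₀ : ℕ, ∃ N : ℕ, N₀ ≤ N ∧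
    ∃ x y : Fin N → Plane, IsMaximalDiscConfig x ∧ IsMaximalDiscConfig y ∧
      ∀ (R : Plane ≃ₗᵢ[ℝ] Plane) (a : Plane),
        c * (N : ℝ) ^ (-(1 / 4 : ℝ)) ≤
          flatNorm (fun φ => empiricalIntegral x φ - empiricalIntegral (fun i => R (y i) + a) φ)

/-! ## §4 Proposition 2.7: uniqueness for hexagonal numbers `N = 3k(k+1) + 1` -/

/-- **`#(𝓛 ∩ conv(B₁^{(k)},…,B₆^{(k)})) = 3k(k+1) + 1`** (the hexagonal numbers; PROVED from the tree's
count of Harborth's lattice hexagon `H_k`). [cite: Schmidt2013, Proposition 2.7 (p0008)] -/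
theorem card_hexagon (k : ℕ) : (hexagon k).card = 3 * k * (k + 1) + 1 := by
  rw [(count_hexagon k).1]; ring

/-- **Schmidt 2013, Proposition 2.7 (uniqueness of the ground state for `N = 3k(k+1)+1`), NAMED FACT.**
For `k` sufficiently large ("`N` sufficiently large", p0005) and `N = 3k(k+1) + 1`, every ground state of
the sticky disc energy with `N` atoms is, up to a rigid motion, `S_N = 𝓛 ∩ conv(B₁^{(k)},…,B₆^{(k)})`,
the lattice points of the regular hexagon with corners `±k e₁, ±k e₂, ±k(e₂ − e₁)` — in labels the tree's
`HarborthSpiral.hexagon k` ("So as `N` grows, the situation changes rapidly between highly degenerate and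
non-degenerate energy levels"). [cite: Schmidt2013, Proposition 2.7 (p0008)] -/
def Schmidt2013_uniqueGroundState : Prop :=
  ∃ k₀ : ℕ, ∀ k : ℕ, k₀ ≤ k → ∀ x : Fin (3 * k * (k + 1) + 1) → Plane, IsMaximalDiscConfig x →
    ∃ (R : Plane ≃ₗᵢ[ℝ] Plane) (a : Plane),
      Set.range (fun i => R (x i) + a) = triPoint '' (↑(hexagon k) : Set (ℤ × ℤ))

/-! ## §5 Proposition 2.7 PROVED: ground states with `N = 3k(k+1) + 1` atoms are regular hexagons

Schmidt's printed proof (p0008): the bond graphs of two ground states triangulate the interiors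
`F`, `F̃` of their boundary polygons into equally many unit triangles (Euler's formula, `#𝓑 = #𝓑̃`,
simple connectivity by Heitmann–Radin), so `|F| = |F̃|` and `𝓗¹(P) = 𝓗¹(P̃)`; the perimeters are
the hexagonal surface energies `∫_{∂F} Γ(ν)`, whose unique volume-constrained minimiser is the Wulff
hexagon (Theorem 2.8: Taylor, Fonseca–Müller), and for `N = 3k(k+1)+1` the regular lattice hexagon
realises it.  The tree proves the statement by a shorter road through Heitmann–Radin's structure
theorem (`Harborth.eq_image_hexagon_of_maximal`, `HeitmannRadinHexagon.lean`): peeling the `6k`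
boundary discs of a hexagonal-number ground state leaves a ground state with the previous hexagonal
number of discs, so by induction the interior is a lattice hexagon `H_{k-1}`, and the six lattice
neighbours of each interior disc are present, which fills `H_k`.  The threshold is `k₀ = 0`. -/

open Literature.Geometry.DiscreteGeometry (harborthNumber)
open Literature.Geometry.DiscreteGeometry.Harborth (framePt framePt_apply eq_image_hexagon_of_maximal
  exp_pi_div_three_mul_I)

/-- Under the isometry `ℝ² ≅ ℂ` (`orthonormalBasisOneI`) the lattice point `triPoint (m, n) =
m t₁ + n t₂` is Heitmann–Radin's `m + n e^{iπ/3}`. [cite: HeitmannRadin1980, §2 (p. 283)]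
[cite: Schmidt2013, §2 (`𝓛`, p0005)] -/
theorem orthonormalBasisOneI_symm_triPoint (q : ℤ × ℤ) :
    Complex.orthonormalBasisOneI.repr.symm (triPoint q) =
      (q.1 : ℂ) + (q.2 : ℂ) * Complex.exp (((Real.pi / 3 : ℝ) : ℂ) * Complex.I) := by
  rw [exp_pi_div_three_mul_I]
  apply Complex.ext
  · simp [Complex.orthonormalBasisOneI_repr_symm_apply]
    ring
  · simp [Complex.orthonormalBasisOneI_repr_symm_apply]
    ring

/-- **Ground states with a hexagonal number of atoms are regular hexagons, up to a ROTATION and a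
translation**: for every `k`, every ground state `x` of `N = 3k(k+1) + 1` sticky discs (`N` as a
variable with `N = 3k(k+1)+1`, so that both spellings `3k(k+1)+1` and `3k² + 3k + 1` apply) satisfies
`{R xᵢ + a} = 𝓛 ∩ conv(B₁^{(k)},…,B₆^{(k)})` (`= triPoint '' hexagon k`) for a linear isometry `R` of
determinant `1` (the rotation `z ↦ ū z` of `ℂ ≅ ℝ²`, Mathlib's `rotation`, conjugated by
`orthonormalBasisOneI`) and a translation `a`.  Transfer of the labelled configuration to its centre
set in `ℂ` (as in `HeitmannRadin1980_groundStates_holds`), maximality from Harborth's construction,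
and `Harborth.eq_image_hexagon_of_maximal`. [cite: Schmidt2013, Proposition 2.7 (p0008)]
[cite: HeitmannRadin1980, Theorem (2)(a)–(b) p. 284] -/
theorem exists_rotation_range_eq_hexagon (k : ℕ) {N : ℕ} (hN : N = 3 * k * (k + 1) + 1)
    (x : Fin N → Plane) (hx : IsMaximalDiscConfig x) :
    ∃ (R : Plane ≃ₗᵢ[ℝ] Plane) (a : Plane),
      LinearMap.det (R.toLinearEquiv : Plane →ₗ[ℝ] Plane) = 1 ∧
        Set.range (fun i => R (x i) + a) = triPoint '' (↑(hexagon k) : Set (ℤ × ℤ)) := by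
  classical
  subst hN
  have hxhard := hx.1
  -- move to `ℂ`
  let e : Plane ≃ₗᵢ[ℝ] ℂ := Complex.orthonormalBasisOneI.repr.symm
  let y : Fin (3 * k * (k + 1) + 1) → ℂ := fun i => e (x i)
  have hdist : ∀ i j, dist (y i) (y j) = dist (x i) (x j) := fun i j => e.dist_map (x i) (x j)
  have hyinj : Function.Injective y := by
    intro i j h
    by_contra hij
    have h1 : 1 ≤ dist (x i) (x j) := hxhard hij
    rw [← hdist, h, dist_self] at h1
    exact absurd h1 (by norm_num)
  let P : Finset ℂ := Finset.univ.image y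
  have hmem : ∀ i, y i ∈ P := fun i => Finset.mem_image_of_mem y (Finset.mem_univ i)
  have hcard : P.card = 3 * k * (k + 1) + 1 := by
    rw [Finset.card_image_of_injective _ hyinj, Finset.card_univ, Fintype.card_fin]
  have hhard : Literature.Geometry.DiscreteGeometry.Harborth.IsHard P := by
    intro p hp q hq hpq
    obtain ⟨i, -, rfl⟩ := Finset.mem_image.1 hp
    obtain ⟨j, -, rfl⟩ := Finset.mem_image.1 hq
    have hij : j ≠ i := fun h => hpq (by rw [h])
    rw [← dist_eq_norm, hdist]
    exact hxhard hij
  -- the centre set carries `2 · contactPairCount x` darts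
  set A := Finset.univ.filter fun p : Fin (3 * k * (k + 1) + 1) × Fin (3 * k * (k + 1) + 1) =>
    p.1 < p.2 ∧ dist (x p.1) (x p.2) = 1 with hA
  have hAc : A.card = contactPairCount x := rfl
  let f : Fin (3 * k * (k + 1) + 1) × Fin (3 * k * (k + 1) + 1) → ℂ × ℂ := fun ij => (y ij.1, y ij.2)
  have hfinj : Function.Injective f := by
    intro a b h
    have h' := Prod.mk.inj h
    exact Prod.ext (hyinj h'.1) (hyinj h'.2)
  have hdisj : Disjoint A (A.image Prod.swap) := by
    rw [Finset.disjoint_left]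
    intro p hp hp'
    obtain ⟨q, hq, hqp⟩ := Finset.mem_image.1 hp'
    rw [hA, Finset.mem_filter] at hp hq
    rw [← hqp, Prod.fst_swap, Prod.snd_swap] at hp
    exact lt_asymm hp.2.1 hq.2.1
  have hsub : (A ∪ A.image Prod.swap).image f ⊆ Literature.Geometry.DiscreteGeometry.Harborth.darts P := by
    intro d hd
    obtain ⟨p, hp, rfl⟩ := Finset.mem_image.1 hd
    have h1 : dist (x p.1) (x p.2) = 1 := by
      rcases Finset.mem_union.1 hp with h | h
      · exact (Finset.mem_filter.1 h).2.2
      · obtain ⟨q, hq, rfl⟩ := Finset.mem_image.1 h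
        rw [Prod.fst_swap, Prod.snd_swap, dist_comm]
        exact (Finset.mem_filter.1 hq).2.2
    refine Literature.Geometry.DiscreteGeometry.Harborth.mem_darts.2 ⟨⟨hmem _, hmem _⟩, ?_⟩
    change ‖y p.2 - y p.1‖ = 1
    rw [← dist_eq_norm, hdist, dist_comm, h1]
  have h2c : 2 * contactPairCount x ≤ (Literature.Geometry.DiscreteGeometry.Harborth.darts P).card := by
    calc 2 * contactPairCount x = (A ∪ A.image Prod.swap).card := by
          rw [Finset.card_union_of_disjoint hdisj,
            Finset.card_image_of_injective _ Prod.swap_injective, hAc]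
          ring
      _ = ((A ∪ A.image Prod.swap).image f).card := (Finset.card_image_of_injective _ hfinj).symm
      _ ≤ (Literature.Geometry.DiscreteGeometry.Harborth.darts P).card := Finset.card_le_card hsub
  -- maximality
  have hge : harborthNumber (3 * k * (k + 1) + 1) ≤ contactPairCount x :=
    hx.harborthNumber_le_contactPairCount
  have hmax : 2 * harborthNumber P.card ≤
      ((Literature.Geometry.DiscreteGeometry.Harborth.darts P).card : ℤ) := by
    rw [hcard]
    have : ((2 * contactPairCount x : ℕ) : ℤ) ≤
        (Literature.Geometry.DiscreteGeometry.Harborth.darts P).card := by exact_mod_cast h2c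
    push_cast at this
    linarith
  -- the centre set is a lattice hexagon `t + u H_k`
  obtain ⟨t, u, hu, hPeq⟩ := eq_image_hexagon_of_maximal hhard (k := k) hcard hmax
  have hu0 : u ≠ 0 := fun h => by rw [h, norm_zero] at hu; exact zero_ne_one hu
  have huinv : ‖u⁻¹‖ = 1 := by rw [norm_inv, hu, inv_one]
  -- the rigid motion `z ↦ ū (z - t)`, conjugated by `e`
  let uc : Circle := ⟨u⁻¹, by simp [Submonoid.unitSphere, huinv]⟩
  let R : Plane ≃ₗᵢ[ℝ] Plane := (e.trans (rotation uc)).trans e.symm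
  have hR : ∀ z : Plane, R z = e.symm (u⁻¹ * e z) := fun z => rfl
  -- `R` is a rotation: `det R = det (z ↦ ū z) = |ū|² = 1`
  have hdet : LinearMap.det (R.toLinearEquiv : Plane →ₗ[ℝ] Plane) = 1 := by
    have hconj : (R.toLinearEquiv : Plane →ₗ[ℝ] Plane) =
        (e.symm.toLinearEquiv : ℂ →ₗ[ℝ] Plane) ∘ₗ
          ((rotation uc).toLinearEquiv : ℂ →ₗ[ℝ] ℂ) ∘ₗ
            (e.symm.toLinearEquiv.symm : Plane →ₗ[ℝ] ℂ) := by
      apply LinearMap.ext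
      intro z
      rfl
    rw [hconj, LinearMap.det_conj]
    exact det_rotation uc
  refine ⟨R, e.symm (-(u⁻¹ * t)), hdet, ?_⟩
  have hmove : ∀ i, R (x i) + e.symm (-(u⁻¹ * t)) = e.symm (u⁻¹ * (y i - t)) := by
    intro i
    rw [hR, ← map_add]
    congr 1
    change u⁻¹ * y i + -(u⁻¹ * t) = u⁻¹ * (y i - t)
    ring
  have hframe : ∀ q : ℤ × ℤ, e.symm (u⁻¹ * (framePt t u q - t)) = triPoint q := by
    intro q
    apply e.injective
    rw [e.apply_symm_apply, framePt_apply, add_sub_cancel_left, ← mul_assoc, inv_mul_cancel₀ hu0,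
      one_mul]
    exact (orthonormalBasisOneI_symm_triPoint q).symm
  ext z
  simp only [Set.mem_range, Set.mem_image, Finset.mem_coe]
  constructor
  · rintro ⟨i, rfl⟩
    have hyi : y i ∈ P := hmem i
    rw [hPeq] at hyi
    obtain ⟨q, hq, hyq⟩ := Finset.mem_image.1 hyi
    exact ⟨q, hq, by rw [hmove, ← hyq, hframe]⟩
  · rintro ⟨q, hq, rfl⟩
    have hqP : framePt t u q ∈ P := by rw [hPeq]; exact Finset.mem_image_of_mem _ hq
    obtain ⟨i, -, hyi⟩ := Finset.mem_image.1 hqP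
    exact ⟨i, by rw [hmove, hyi, hframe]⟩

/-- **Schmidt 2013, Proposition 2.7 HOLDS** (with threshold `k₀ = 0`): for every `k` and
`N = 3k(k+1) + 1`, every ground state of `N` sticky discs is, up to a rigid motion, the set
`𝓛 ∩ conv(B₁^{(k)},…,B₆^{(k)})` of lattice points of the regular hexagon of side `k`.  Discharge of the
named fact `Schmidt2013_uniqueGroundState` (`exists_rotation_range_eq_hexagon`, forgetting `det R = 1`).
[cite: Schmidt2013, Proposition 2.7 (p0008)] -/
theorem Schmidt2013_uniqueGroundState_holds : Schmidt2013_uniqueGroundState :=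
  ⟨0, fun k _ x hx =>
    let ⟨R, a, _, h⟩ := exists_rotation_range_eq_hexagon k rfl x hx
    ⟨R, a, h⟩⟩

end Literature.MathematicalPhysics.StatisticalMechanics.Schmidt2013

end
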